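import Summits.AtomisticToContinuum.HydrodynamicLimit.Theorems.CollisionIsometryCLTMacroClosureStubLedgerTransport
import Summits.AtomisticToContinuum.HydrodynamicLimit.Theorems.JaynesSqueezeSqueezeToBlockGibbsMeasurableRef

/-!
# The squeeze `SqueezeToBlockGibbs` (route JaynesSqueeze), I: bounded measurable local Gibbs references

Helper file (`--supports stmt-AtomisticToContinuum-13463`) for the support item `SqueezeToBlockGibbs` of route
`JaynesSqueeze` (`Summit.AtomisticToContinuum.HydrodynamicLimit.Theses.JaynesSqueeze.SqueezeToBlockGibbs`).
Step (i) of the item's plan — the exact finite-`N` bookkeeping identity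

  `KL(lawAt Φ λ_N t ‖ Ψ)/(N+1) = [E_λ⟨emp, log prof₀⟩ − (N+1)⁻¹ log Z₀] − [E_λ⟨emp ∘ Φ_t, log prof⟩ − (N+1)⁻¹ log Z]`

for the evolved local Gibbs law `λ_N = localGibbsLaw σ a₀ u₀ θ₀ N Φ` (continuous positive data profiles) and a
reference local Gibbs law `Ψ = localGibbsLaw σ a u θ N Φ` whose parameters are merely MEASURABLE and bounded
(`A⁻¹ ≤ a ≤ A`, `Θ⁻¹ ≤ θ ≤ Θ`, `‖u‖ ≤ V`) — the block-constant references of the waypoint `BlockGibbs` are not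
continuous (they are probability measures for `σ ≤ 1/2`, part 0). This is the two-reference Liouville transport identity
`MacroClosureLine.StubLedger.toReal_klDiv_lawAt_particleLaw` (Liouville invariance + log-linearity of the Gibbs
density) with the first reference equal to the initial law; the present file supplies the measurable-parameter
quadratic velocity bound on `log prof` with constants depending only on `(A, Θ, V)` and the integrability of the
log-pairing from the kinetic energy (the measurability / positivity / `log (Z⁻¹∏ prof)` bookkeeping for measurable
profiles being those of part 0, `JaynesSqueezeSqueezeToBlockGibbsMeasurableRef`), and also records
that the relative entropy is FINITE (`klDiv ≠ ⊤`), which the `toReal` identity does not see.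

References: Yau 1991 §2; Olla–Varadhan–Yau 1993 §3 (relative entropy method); Csiszár 1975 (I-projection).
-/

noncomputable section

open MeasureTheory Filter Set Topology InformationTheory
open scoped ENNReal

namespace Summit.AtomisticToContinuum.HydrodynamicLimit.Theorems.JaynesSqueezeSqueeze

open Literature.MathematicalPhysics.KineticTheory Literature.Analysis.FluidPDE
open Literature.Analysis.FunctionSpaces
open MacroClosureLine.StubLedger

/-! ## The quadratic velocity bound with constants depending only on the parameter bounds -/

/-- **Quadratic velocity bound, uniform over bounded parameters.** For `A, Θ ≥ 1` and `V` there is `C ≥ 0`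
such that every parameter triple with `A⁻¹ ≤ a ≤ A`, `Θ⁻¹ ≤ θ ≤ Θ`, `‖u‖ ≤ V` has
`|log prof(x, v)| ≤ C (1 + ‖v‖²)`. [folklore] -/
theorem exists_abs_log_localGibbsProfile_le_of_bounds {A Θ : ℝ} (V : ℝ) (hA : 1 ≤ A) (hΘ : 1 ≤ Θ) :
    ∃ C : ℝ, 0 ≤ C ∧ ∀ (a θ : T3 → ℝ) (u : T3 → V3), (∀ x, A⁻¹ ≤ a x ∧ a x ≤ A) →
      (∀ x, Θ⁻¹ ≤ θ x ∧ θ x ≤ Θ) → (∀ x, ‖u x‖ ≤ V) →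
        ∀ x v, |Real.log (localGibbsProfile a u θ (x, v))| ≤ C * (1 + ‖v‖ ^ 2) := by
  set r : ℝ := -(Module.finrank ℝ V3 : ℝ) / 2 with hr
  have hlogA : 0 ≤ Real.log A := Real.log_nonneg hA
  have hlogΘ : 0 ≤ Real.log Θ := Real.log_nonneg hΘ
  have h2π : 1 ≤ 2 * Real.pi := by linarith [Real.pi_gt_three]
  have hlog2π : 0 ≤ Real.log (2 * Real.pi) := Real.log_nonneg h2π
  refine ⟨Real.log A + |r| * (Real.log (2 * Real.pi) + Real.log Θ) + Θ * V ^ 2 + Θ, by positivity, ?_⟩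
  intro a θ u hba hbθ hbu x v
  have hApos : 0 < A := by linarith
  have hΘpos : 0 < Θ := by linarith
  have hax : 0 < a x := (inv_pos.2 hApos).trans_le (hba x).1
  have hθx : 0 < θ x := (inv_pos.2 hΘpos).trans_le (hbθ x).1
  rw [log_localGibbsProfile_eq x v hax hθx]
  -- `|log a| ≤ log A`
  have h1 : |Real.log (a x)| ≤ Real.log A := by
    rw [abs_le]
    constructor
    · rw [← Real.log_inv]
      exact Real.log_le_log (inv_pos.2 hApos) (hba x).1
    · exact Real.log_le_log hax (hba x).2
  -- `|log (2πθ)^r| ≤ |r| (log 2π + log Θ)`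
  have h2 : |Real.log ((2 * Real.pi * θ x) ^ r)| ≤ |r| * (Real.log (2 * Real.pi) + Real.log Θ) := by
    have hpos : 0 < 2 * Real.pi * θ x := mul_pos (by linarith) hθx
    rw [Real.log_rpow hpos, abs_mul, Real.log_mul (by linarith : (2 * Real.pi) ≠ 0) hθx.ne']
    refine mul_le_mul_of_nonneg_left ?_ (abs_nonneg _)
    have hθlog : |Real.log (θ x)| ≤ Real.log Θ := by
      rw [abs_le]
      constructor
      · rw [← Real.log_inv]
        exact Real.log_le_log (inv_pos.2 hΘpos) (hbθ x).1
      · exact Real.log_le_log hθx (hbθ x).2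
    calc |Real.log (2 * Real.pi) + Real.log (θ x)| ≤ |Real.log (2 * Real.pi)| + |Real.log (θ x)| := abs_add_le _ _
      _ ≤ Real.log (2 * Real.pi) + Real.log Θ := by rw [abs_of_nonneg hlog2π]; linarith
  -- the quadratic term
  have h3 : ‖v - u x‖ ^ 2 / (2 * θ x) ≤ Θ * V ^ 2 + Θ * ‖v‖ ^ 2 := by
    have hinv : (2 * θ x)⁻¹ ≤ Θ / 2 := by
      rw [mul_inv, show Θ / 2 = 2⁻¹ * Θ by ring]
      refine mul_le_mul_of_nonneg_left ?_ (by norm_num)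
      rw [inv_le_comm₀ hθx hΘpos]
      exact (hbθ x).1
    have htri : ‖v - u x‖ ≤ ‖v‖ + ‖u x‖ := norm_sub_le v (u x)
    have hsq1 : ‖v - u x‖ ^ 2 ≤ (‖v‖ + ‖u x‖) ^ 2 := by gcongr
    have hu2 : ‖u x‖ ^ 2 ≤ V ^ 2 := by gcongr; exact hbu x
    have hsq : ‖v - u x‖ ^ 2 ≤ 2 * ‖v‖ ^ 2 + 2 * V ^ 2 := by
      nlinarith [hsq1, hu2, sq_nonneg (‖v‖ - ‖u x‖)]
    rw [div_eq_inv_mul]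
    calc (2 * θ x)⁻¹ * ‖v - u x‖ ^ 2 ≤ (Θ / 2) * (2 * ‖v‖ ^ 2 + 2 * V ^ 2) :=
          mul_le_mul hinv hsq (sq_nonneg _) (by positivity)
      _ = Θ * V ^ 2 + Θ * ‖v‖ ^ 2 := by ring
  have h3nn : 0 ≤ ‖v - u x‖ ^ 2 / (2 * θ x) := div_nonneg (sq_nonneg _) (by positivity)
  have hA1 := abs_le.1 h1
  have hB1 := abs_le.1 h2
  have hrnn : 0 ≤ |r| * (Real.log (2 * Real.pi) + Real.log Θ) := by positivity
  rw [abs_le]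
  constructor <;> nlinarith [hA1.1, hA1.2, hB1.1, hB1.2, h3, h3nn, hrnn, hlogA,
    mul_nonneg hlogA (sq_nonneg ‖v‖), mul_nonneg hrnn (sq_nonneg ‖v‖),
    mul_nonneg (mul_nonneg hΘpos.le (sq_nonneg V)) (sq_nonneg ‖v‖), mul_nonneg hΘpos.le (sq_nonneg ‖v‖)]

/-- **Integrability of the log-profile pairing of bounded measurable parameters along a measurable map** (the
flow at a fixed time, or the identity): if the kinetic energy `⟨emp (T z), |v|²⟩` is integrable under a finite
law `P`, so is `⟨emp (T ·), log prof⟩`. [folklore] -/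
theorem integrable_logPair_comp' {N : ℕ} {a θ : T3 → ℝ} {u : T3 → V3} (ha : Measurable a)
    (hθ : Measurable θ) (hu : Measurable u) {C : ℝ}
    (hC : ∀ x v, |Real.log (localGibbsProfile a u θ (x, v))| ≤ C * (1 + ‖v‖ ^ 2))
    {P : Measure (Config (N + 1) (Fin 3) T3)} [IsFiniteMeasure P]
    {T : Config (N + 1) (Fin 3) T3 → Config (N + 1) (Fin 3) T3} (hT : Measurable T)
    (hK : Integrable (fun z => ∫ y, ‖y.2‖ ^ 2 ∂(empiricalMeasure (T z))) P) :
    Integrable (fun z => (∫ y, Real.log (localGibbsProfile a u θ y) ∂(empiricalMeasure (T z)))) P := by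
  refine Integrable.mono' ((integrable_const C).add (hK.const_mul C))
    (measurable_logPair_comp hT ha hθ hu).aestronglyMeasurable (ae_of_all _ fun z => ?_)
  rw [Real.norm_eq_abs]
  calc |(∫ y, Real.log (localGibbsProfile a u θ y) ∂(empiricalMeasure (T z)))|
      ≤ C * (1 + ∫ y, ‖y.2‖ ^ 2 ∂(empiricalMeasure (T z))) := abs_logPair_le hC (T z)
    _ = C + C * ∫ y, ‖y.2‖ ^ 2 ∂(empiricalMeasure (T z)) := by ring

/-! ## The bookkeeping identity for a bounded measurable reference -/

/-- **Exact finite-`N` bookkeeping (step (i) of `SqueezeToBlockGibbs`).** For the hard-sphere system at reduced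
diameter `σ ≤ 1/2` started from the local Gibbs law `λ_N = localGibbsLaw σ a₀ u₀ θ₀ N Φ` of continuous positive
profiles, and a reference `Ψ = localGibbsLaw σ a u θ N Φ` with measurable parameters bounded by `(A, Θ, V)`: if
the kinetic energy is `λ_N`-integrable at times `0` and `t`, then
`KL(lawAt Φ λ_N t ‖ Ψ) = (N+1)(E_λ⟨emp, log prof₀⟩ − E_λ⟨emp ∘ Φ_t, log prof⟩) + log Z − log Z₀` and this
relative entropy is finite. (Liouville invariance of the fine-grained entropy; `log Ψ`-density is a one-body sum.)
[folklore] -/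
theorem toReal_klDiv_lawAt_localGibbsLaw_ref {σ : ℝ} (hσ2 : σ ≤ 1 / 2) (N : ℕ)
    (Φ : HardSphereFlow (Torus.geometry (Fin 3)) (hsDiameter σ N) (N + 1))
    {a₀ θ₀ : T3 → ℝ} {u₀ : T3 → V3} (ha : Continuous a₀) (hθ : Continuous θ₀) (hu : Continuous u₀)
    (ha0 : ∀ x, 0 < a₀ x) (hθ0 : ∀ x, 0 < θ₀ x)
    {a θ : T3 → ℝ} {u : T3 → V3} (hma : Measurable a) (hmθ : Measurable θ) (hmu : Measurable u)
    {A Θ V : ℝ} (hA : 1 ≤ A) (hΘ : 1 ≤ Θ) (hba : ∀ x, A⁻¹ ≤ a x ∧ a x ≤ A)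
    (hbθ : ∀ x, Θ⁻¹ ≤ θ x ∧ θ x ≤ Θ) (hbu : ∀ x, ‖u x‖ ≤ V) (t : ℝ)
    (hK0 : Integrable (fun z => ∫ y, ‖y.2‖ ^ 2 ∂(empiricalMeasure z)) (localGibbsLaw σ a₀ u₀ θ₀ N Φ))
    (hKt : Integrable (fun z => ∫ y, ‖y.2‖ ^ 2 ∂(empiricalMeasure (Φ.flow t z)))
      (localGibbsLaw σ a₀ u₀ θ₀ N Φ)) :
    (klDiv (Φ.lawAt (localGibbsLaw σ a₀ u₀ θ₀ N Φ) t) (localGibbsLaw σ a u θ N Φ)).toReal =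
        ((N : ℝ) + 1) *
            ((∫ z, (∫ y, Real.log (localGibbsProfile a₀ u₀ θ₀ y) ∂(empiricalMeasure z))
                ∂(localGibbsLaw σ a₀ u₀ θ₀ N Φ)) -
              ∫ z, (∫ y, Real.log (localGibbsProfile a u θ y) ∂(empiricalMeasure (Φ.flow t z)))
                ∂(localGibbsLaw σ a₀ u₀ θ₀ N Φ)) +
          Real.log (canonicalPartition (Torus.geometry (Fin 3)) (hsDiameter σ N) (N + 1) (localGibbsProfile a u θ)) -
          Real.log (canonicalPartition (Torus.geometry (Fin 3)) (hsDiameter σ N) (N + 1)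
            (localGibbsProfile a₀ u₀ θ₀)) ∧
      klDiv (Φ.lawAt (localGibbsLaw σ a₀ u₀ θ₀ N Φ) t) (localGibbsLaw σ a u θ N Φ) ≠ ⊤ := by
  have hApos : 0 < A := by linarith
  have hΘpos : 0 < Θ := by linarith
  have ha0' : ∀ x, 0 < a x := fun x => (inv_pos.2 hApos).trans_le (hba x).1
  have hθ0' : ∀ x, 0 < θ x := fun x => (inv_pos.2 hΘpos).trans_le (hbθ x).1
  -- the partition functions
  set Z₀ := canonicalPartition (Torus.geometry (Fin 3)) (hsDiameter σ N) (N + 1) (localGibbsProfile a₀ u₀ θ₀)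
    with hZ₀_def
  set Z := canonicalPartition (Torus.geometry (Fin 3)) (hsDiameter σ N) (N + 1) (localGibbsProfile a u θ)
    with hZ_def
  have hZ₀ : 0 < Z₀ := canonicalPartition_localGibbs_pos hσ2 N ha hθ hu ha0 hθ0
  have hZ : 0 < Z := canonicalPartition_pos_of_bounds hma hmθ hmu (inv_pos.2 hApos) hba hθ0' hσ2 N
  haveI hΨ : IsProbabilityMeasure (localGibbsLaw σ a u θ N Φ) :=
    isProbabilityMeasure_localGibbsLaw_of_bounds hma hmθ hmu (inv_pos.2 hApos) hba hθ0' hσ2 N Φ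
  -- the two densities
  set W₀ : Config (N + 1) (Fin 3) T3 → ℝ := fun z => Z₀⁻¹ * tensorPow (N + 1) (localGibbsProfile a₀ u₀ θ₀) z
    with hW₀_def
  set ψ : Config (N + 1) (Fin 3) T3 → ℝ := fun z => Z⁻¹ * tensorPow (N + 1) (localGibbsProfile a u θ) z
    with hψ_def
  have hPW : localGibbsLaw σ a₀ u₀ θ₀ N Φ = particleLaw Φ W₀ := localGibbsLaw_eq_particleLaw_tensorPow Φ _ _ _
  have hΨψ : localGibbsLaw σ a u θ N Φ = particleLaw Φ ψ := localGibbsLaw_eq_particleLaw_tensorPow Φ _ _ _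
  haveI hP : IsProbabilityMeasure (particleLaw Φ W₀) := by
    rw [← hPW]; exact isProbabilityMeasure_localGibbsLaw ha hθ hu ha0 hθ0 hσ2 N Φ
  haveI hΨ' : IsProbabilityMeasure (particleLaw Φ ψ) := by rw [← hΨψ]; exact hΨ
  have hWm : Measurable W₀ := measurable_gibbsDensity σ N ha hθ hu
  have hψm : Measurable ψ :=
    measurable_const.mul (measurable_tensorPow (stronglyMeasurable_localGibbsProfile hma hmθ hmu).measurable _)
  have hWpos : ∀ z, 0 < W₀ z := gibbsDensity_pos hσ2 N ha hθ hu ha0 hθ0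
  have hψpos : ∀ z, 0 < ψ z := gibbsDensity_pos_of_pos N ha0' hθ0' hZ
  -- log-densities as one-body sums
  set L₀ : Config (N + 1) (Fin 3) T3 → ℝ := fun z =>
    ∫ y, Real.log (localGibbsProfile a₀ u₀ θ₀ y) ∂(empiricalMeasure z) with hL₀
  set L : Config (N + 1) (Fin 3) T3 → ℝ := fun z =>
    ∫ y, Real.log (localGibbsProfile a u θ y) ∂(empiricalMeasure z) with hL
  have hlogW : ∀ z, Real.log (W₀ z) = ((N : ℝ) + 1) * L₀ z - Real.log Z₀ :=
    log_gibbsDensity hσ2 N ha hθ hu ha0 hθ0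
  have hlogψ : ∀ z, Real.log (ψ z) = ((N : ℝ) + 1) * L z - Real.log Z := log_gibbsDensity_of_pos N ha0' hθ0' hZ
  -- integrability of the two log-pairings from the kinetic energy
  rw [hPW] at hK0 hKt
  obtain ⟨C, -, hC⟩ := exists_abs_log_localGibbsProfile_le_of_bounds V hA hΘ
  have hI₀ : Integrable (fun z => L₀ z) (particleLaw Φ W₀) :=
    integrable_logPair_comp ha hθ hu ha0 hθ0 measurable_id hK0
  have hI : Integrable (fun z => L (Φ.flow t z)) (particleLaw Φ W₀) :=
    integrable_logPair_comp' hma hmθ hmu (hC a θ u hba hbθ hbu) (Φ.measurable_flow t) hKt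
  have hint₁ : Integrable (fun z => Real.log (W₀ z)) (particleLaw Φ W₀) := by
    simp_rw [hlogW]; exact (hI₀.const_mul _).sub (integrable_const _)
  have hint₂ : Integrable (fun z => Real.log (ψ (Φ.flow t z))) (particleLaw Φ W₀) := by
    simp_rw [hlogψ]; exact (hI.const_mul _).sub (integrable_const _)
  have hkl : klDiv (particleLaw Φ W₀) (particleLaw Φ W₀) ≠ ⊤ := by
    rw [klDiv_self]; exact ENNReal.zero_ne_top
  rw [hPW, hΨψ]
  refine ⟨?_, ?_⟩
  · -- the identity
    rw [toReal_klDiv_lawAt_particleLaw Φ hWm hWm hψm (fun z => (hWpos z).le) hWpos hψpos hkl t hint₁ hint₂,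
      klDiv_self, ENNReal.toReal_zero, zero_add]
    simp_rw [hlogW, hlogψ]
    have hA₁ : Integrable (fun z => ((N : ℝ) + 1) * L₀ z) (particleLaw Φ W₀) := hI₀.const_mul _
    have hA₂ : Integrable (fun z => ((N : ℝ) + 1) * L (Φ.flow t z)) (particleLaw Φ W₀) := hI.const_mul _
    have hA₃ : Integrable (fun z => ((N : ℝ) + 1) * L₀ z - ((N : ℝ) + 1) * L (Φ.flow t z)) (particleLaw Φ W₀) :=
      hA₁.sub hA₂
    have hB : Integrable (fun _ : Config (N + 1) (Fin 3) T3 => Real.log Z - Real.log Z₀) (particleLaw Φ W₀) :=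
      integrable_const _
    rw [show (fun z => ((N : ℝ) + 1) * L₀ z - Real.log Z₀ - (((N : ℝ) + 1) * L (Φ.flow t z) - Real.log Z)) =
        fun z => ((N : ℝ) + 1) * L₀ z - ((N : ℝ) + 1) * L (Φ.flow t z) + (Real.log Z - Real.log Z₀) from
        funext fun z => by ring,
      integral_add hA₃ hB, integral_sub hA₁ hA₂, integral_const_mul, integral_const_mul, integral_const,
      smul_eq_mul, probReal_univ, one_mul]
    ring
  · -- finiteness
    have hf : Measurable fun z => ENNReal.ofReal (W₀ z) := ENNReal.measurable_ofReal.comp hWm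
    have hμL : particleLaw Φ W₀ ≪ liouville (Torus.geometry (Fin 3)) (N + 1) (hsDiameter σ N) :=
      withDensity_absolutelyContinuous _ _
    have hlaw : Φ.lawAt (particleLaw Φ W₀) t = particleLaw Φ fun z => W₀ (Φ.flow (-t) z) :=
      HardSphereFlow.lawAt_withDensity_holds Φ hf t
    haveI hPt : IsProbabilityMeasure (particleLaw Φ fun z => W₀ (Φ.flow (-t) z)) := by
      rw [← hlaw, HardSphereFlow.lawAt_eq]
      exact Measure.isProbabilityMeasure_map (Φ.measurable_flow t).aemeasurable
    have hg : Measurable fun z => ENNReal.ofReal (ψ z) := ENNReal.measurable_ofReal.comp hψm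
    have hg0 : ∀ᵐ z ∂(liouville (Torus.geometry (Fin 3)) (N + 1) (hsDiameter σ N)), ENNReal.ofReal (ψ z) ≠ 0 :=
      ae_of_all _ fun z => (ENNReal.ofReal_pos.mpr (hψpos z)).ne'
    have hLν : liouville (Torus.geometry (Fin 3)) (N + 1) (hsDiameter σ N) ≪ particleLaw Φ ψ :=
      withDensity_absolutelyContinuous' hg.aemeasurable hg0
    have hac : Φ.lawAt (particleLaw Φ W₀) t ≪ particleLaw Φ ψ := by
      rw [hlaw]
      exact (withDensity_absolutelyContinuous _ _).trans hLν
    refine klDiv_ne_top_iff.2 ⟨hac, ?_⟩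
    have hllr := llr_particleLaw_ae (W := fun z => W₀ (Φ.flow (-t) z)) Φ (hWm.comp (Φ.measurable_flow (-t)))
      hψm (fun z => (hWpos _).le) hψpos
    rw [hlaw]
    refine Integrable.congr ?_ hllr.symm
    rw [← hlaw, HardSphereFlow.lawAt_eq]
    have hF : Measurable fun x => Real.log (W₀ (Φ.flow (-t) x)) - Real.log (ψ x) :=
      (Real.measurable_log.comp (hWm.comp (Φ.measurable_flow (-t)))).sub (Real.measurable_log.comp hψm)
    refine (integrable_map_measure hF.aestronglyMeasurable (Φ.measurable_flow t).aemeasurable).2 ?_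
    have hgood : ∀ᵐ z ∂(particleLaw Φ W₀), z ∈ Φ.good := hμL.ae_le Φ.ae_mem_good
    refine (hint₁.sub hint₂).congr ?_
    filter_upwards [hgood] with z hz
    simp only [Function.comp_apply, Pi.sub_apply]
    rw [Φ.flow_neg_flow t hz]

end Summit.AtomisticToContinuum.HydrodynamicLimit.Theorems.JaynesSqueezeSqueeze

end
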